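import Summits.QuantumFields.BalabanUV.Beta.FP.TorusCompositeObjectsG
import Summits.QuantumFields.BalabanUV.Beta.FP.TorusEffFormComposite
import Summits.QuantumFields.BalabanUV.Beta.FP.RelInvPeriodisedCombTorusLetters

/-!
# `BalabanUV.Beta.FP.TorusEffFormCompositeG` — road «FP» for binder row D1, ROUTE T, the (j, m) torus call for `m ≥ 2` UNDER THE ROW's RULING
# R-D1-g52-1 (β1) (journal l.56283): **(INV-m) ∧ (EFF-m) BY ONE JOINT INDUCTION ON THE DEPTH, GENERIC OVER THE ONE-STEP ROW FAMILY AND THE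
# ONE-STEP FINE FORM, WITH THE TWO ONE-STEP LETTERS DISPLAYED — AND ITS (0.4)-SYMMETRISED INSTANCE** (the leaf-05 item the OWNER d1-p3 g29's
# R-FP-69 (b)∕(c) names for the first re-composed tower file, journal l.56319; OFFER O-leaf05-g40-1 l.56303 ∕ E-leaf05-g40-1 l.56329)

WHAT.  `TorusEffFormComposite.torus_composite_inv_and_eff` (this lineage, gen 28) proves, for leaf-06's ROOTED comb tower
(`compRows ∕ nestedSlice` over `Qstep`, i.e. over the rooted step kernel `bhKStepAt d (toSite r) Lc ℓ`), that the `(n+1)`-step composite sliced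
system is (INV) non-degenerate and (EFF) has effective-form corner `(∏ i ∈ range (n+1), (wVH d Lc (lev i))⁻¹) •` the top level's field block —
by induction on the depth, closing at each storey by exactly TWO one-step letters: `h1` (the one-step comb-sliced fine system is non-degenerate,
the OWNER's `NestedStepLawTorusInstance.torus_h1`) and `hId` (its effective corner is the next level's field block up to `(wVH (ℓ+1))⁻¹`,
this lineage's `RelInvPeriodisedEffFormCoarse.hId_order_zero_record`), plus the brick-free Schur-complement algebra of `EffFormTower` §2–§3 and the
OWNER's matrix-generic `NestedStepLawOneShot.det_kkt_compSliced_ne_zero`.  §1 re-runs THAT induction ONCE over leaf-06 g32's GENERIC tower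
`compRowsG Lc Q ∕ nestedSliceG Lc Q` (`FP/TorusCompositeObjectsG`, `Q : StepRows d Lc` an abstract one-step row family) and an abstract
one-step fine-form kernel family `K : ℕ → (Fin (d+1) → ℕ) → MKer (d+1) (Fib d)` (level, root), with the two letters DISPLAYED as hypotheses
indexed by the storey `k` (root `rs k`, level `lev k`, every torus `M′`):
`torus_composite_inv_and_eff_G`.  §2 checks (an `example`, nothing new) that at `Q := Qstep Lc`, `K ℓ r := bhKStepAt d (toSite r) Lc ℓ` the
generic theorem, fed `torus_h1 ∕ hId_order_zero_record` and read through leaf-06's bridges `compRows_eq_compRowsG ∕ nestedSlice_eq_nestedSliceG`,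
IS gen 28's rooted theorem.  §3 is the item the re-based tower consumes: **`torus_composite_inv_and_eff_sym`** — the generic theorem at leaf-06's
`QSym ∕ QstepSym ∕ compRowsSym ∕ nestedSliceSym` (one-step rows over an1's shifted straight spread `bhKStepSh d Lc (Dsh Lc) ℓ`), `K ℓ _ :=
bhKStepSh d Lc (Dsh Lc) ℓ`, at the CENTRED comb root `rs k := ctrOff (d+1) Lc` at every storey, fed this lineage's chart-(III′) torus letters
`RelInvPeriodisedCombTorusLetters.torus_h1_comb ∕ hId_comb` (which live at the centred root only: `relInv_GcombSh_bhKStepSh`).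

WHY (located).  R-D1-g52-1 (3)(b): the composite tower is re-based on the (0.4)-symmetrised bricks at the centred root; (3)(c) → the OWNER: the
re-compositions #19(+Gen)∕#20∕#21 AFTER the suppliers' sym instances; R-FP-69 (b)∕(c): #19 `NestedStepLawTorusComposite` :209 (`have hIE :=
torus_composite_inv_and_eff …`), `…Gen`, #20 :272, #21 :214 (and leaf-06's `NestedDeadRowsOrderTwoTowerClosed` :120) consume (INV-m) ∧ (EFF-m)
BY NAME, so its sym instance must exist before the first re-composed file.  Nothing landed is touched: gen 28's theorem and its consumers stand;
this file is a NEW sibling.  [folklore] Schur-complement bookkeeping BY NAME over OUR typed objects (leaf-06's towers, an1's ∕ an2's one-step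
kernels); no `def`, no `def … : Prop`, nothing cited, 0 sorry, default heartbeats; nothing of the dictionary ∕ Bałaban's asserted, valued or
discharged — WHICH presentation the record's tower takes is the ROW's ruling, quoted, not adjudicated; 0 estimates; 0∕4 row-D1 binders
(hW, hR, D1Tel, D1Rep); NOT (C1), NOT (T-ID), NOT SDF, NOT D1, NEVER «G-an2-4 closed», NOT BetaPertH, NOT continuum, NOT Clay.

HONEST DEPENDENCY (page 1, mandatory): continuum YM on T⁴ ⇐ BetaPertH ∧ nine spine estimates (0/9 proved); BetaPertH ⇐ (D1) ∧ (D4) ∧ CAP+tail;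
G-an2-4 gates asym, D1 and NE2/3/4.  HONEST FRAMING (cell contract, verbatim): «discharging `BetaPertH` makes Bałaban's UV stability UNCONDITIONAL —
a real constructive-QFT result; it is NOT the continuum limit and NOT the Clay problem.»  ABSOLUTE RULE (cell charter, verbatim): «No internally-minted
statement may enter as a cited fact. Every hypothesis is either kernel-proved in this package or a verbatim quotation of a PUBLISHED theorem with page
reference. The manuscript(s) under audit are NOT citable for their own disputed steps — they are the thing under adjudication; programme-internal
(2001/route/tribunal) claims are never citable.»  D1 formalisation swarm LEAF PROVER 05 (b2b-balaban-beta-d1-formalise-leaf-05 gen 40), 2026-08-24.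
No existing file touched.
-/

noncomputable section

open scoped BigOperators

namespace Summit.QuantumFields.BalabanUV.Beta.FP.TorusEffFormCompositeG

open Matrix Finset
open Literature.MathematicalPhysics.QuantumFieldTheory.Balaban1983to89
open Literature.MathematicalPhysics.QuantumFieldTheory.Balaban1983to89.Beta
open Literature.MathematicalPhysics.QuantumFieldTheory.Balaban1983to89.Beta.Composition (kkt)
open Literature.MathematicalPhysics.QuantumFieldTheory.Balaban1983to89.Beta.CompositionSingular (effForm)
open B5Prop11Plancherel (fine)
open B6Lemma24Torus (pbox)
open AffineAveraging (Site box toSite)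
open AveragingContoursRooted (ctrOff)
open ExpKernelCalculus (MKer)
open OneStepResolventKernel (Fib)
open BalabanStepJetsSucc (wVH)
open Summit.QuantumFields.BalabanUV.Beta.BorderedHessian (bhKStepAt)
open Summit.QuantumFields.BalabanUV.Beta.SymShiftedSpread (bhKStepSh)
open Summit.QuantumFields.BalabanUV.Beta.DshAn1 (Dsh)
open Summit.QuantumFields.BalabanUV.Beta.FP.KernelPeriodisationFib (Idx perF)
open Summit.QuantumFields.BalabanUV.Beta.FP.TorusGaugeCovarianceCoarse (coarsePt coarsePt_coe)
open Summit.QuantumFields.BalabanUV.Beta.FP.TorusCombRows (Res combRowsT)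
open Summit.QuantumFields.BalabanUV.Beta.FP.TorusCompositeObjects (towerTorus Qstep combF compRows nestedSlice)
open Summit.QuantumFields.BalabanUV.Beta.FP.TorusCompositeObjectsG (StepRows compRowsG nestedSliceG compRowsG_succ compRowsG_one
  nestedSliceG_succ QstepSym QSym compRowsSym nestedSliceSym compRows_eq_compRowsG nestedSlice_eq_nestedSliceG)
open Summit.QuantumFields.BalabanUV.Beta.FP.EffFormTower (effForm_nested_corner_assoc effForm_smul_form_toBlocks₁₁ det_kkt_fromRows_assoc)
open Summit.QuantumFields.BalabanUV.Beta.FP.RelInvPeriodisedEffFormCoarse (hId_order_zero_record wVH_pos)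
open Summit.QuantumFields.BalabanUV.Beta.FP.RelInvPeriodisedCoarse (det_kkt_smul_form_ne_zero_iff)
open Summit.QuantumFields.BalabanUV.Beta.FP.NestedStepLawTorusInstance (torus_h1 coarseSlot_injective coarseSlot_range)
open Summit.QuantumFields.BalabanUV.Beta.FP.NestedStepLawOneShot (det_kkt_compSliced_ne_zero)
open Summit.QuantumFields.BalabanUV.Beta.FP.RelInvPeriodisedCombTorusLetters (torus_h1_comb hId_comb)

variable {d : ℕ} (Lc : ℕ) [NeZero Lc]

/-! ## §1 (INV-m) ∧ (EFF-m) for the generic tower, the two one-step letters displayed -/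

set_option synthInstance.maxSize 1024 in
/-- **[folklore] (INV-m) ∧ (EFF-m) FOR THE GENERIC TOWER, JOINTLY, BY INDUCTION ON THE DEPTH WITH THE TOP TORUS GENERALISED.**  Data: an abstract
one-step row family `Q : StepRows d Lc` (leaf-06's `compRowsG ∕ nestedSliceG` build the tower from it) and an abstract one-step FINE-FORM kernel
family `K ℓ r : MKer (d+1) (Fib d)` (level `ℓ`, root `r`; only its field–field block, periodised, is read).  For a top torus `M`, a CONSECUTIVE level
sequence `lev` (from the top, `lev i = lev (i+1) + 1`) and a root sequence `rs`, ASSUME the two one-step letters at every storey `k` and on every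
torus `M′`: (h1)ₖ the one-step comb-sliced fine system `(𝓚(fine Lc M′, lev k, rs k) ; [Q M′ (lev k) (rs k); combF Lc (fine Lc M′) (rs k)])` is
non-degenerate, and (hId)ₖ its effective-form corner is `(wVH d Lc (lev k + 1))⁻¹ • 𝓚(M′, lev k + 1, r′)` for every root `r′` — writing
`𝓚(T, ℓ, r)` IN PROSE ONLY for `(perF T (K ℓ r)).submatrix (inl) (inl)` (spelled out in the signature; no notation is declared).  THEN the
`(n+1)`-step composite sliced system `(𝓚(towerTorus Lc M (n+1), lev (n+1), rs (n+1)) ; [compRowsG Lc Q M lev rs (n+1); nestedSliceG Lc Q (fine Lc M)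
(lev ∘ succ) (rs ∘ succ) n])` has (i) a non-degenerate bordered matrix and (ii) effective-form corner `(∏ i ∈ range (n+1), (wVH d Lc (lev i))⁻¹) •
𝓚(M, lev 0, r′)` for every `r′`.  (Gen 28's proof verbatim with `Qstep ↦ Q`, `compRows ↦ compRowsG Lc Q`, `nestedSlice ↦ nestedSliceG Lc Q`,
`torus_h1 ↦ (h1)₁`, `hId_order_zero_record ↦ (hId)₁`; the induction hypothesis is the tower below `M` with the sequences shifted by one.) -/
theorem torus_composite_inv_and_eff_G (Q : StepRows d Lc) (K : ℕ → (Fin (d + 1) → ℕ) → MKer (d + 1) (Fib d)) (n : ℕ) :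
    ∀ (M : Fin (d + 1) → ℕ) [∀ μ, NeZero (M μ)] (lev : ℕ → ℕ) (rs : ℕ → (Fin (d + 1) → ℕ)),
      (∀ i, lev i = lev (i + 1) + 1) →
      (∀ (k : ℕ) (M' : Fin (d + 1) → ℕ) [∀ μ, NeZero (M' μ)],
        (kkt ((perF (fine Lc M') (K (lev k) (rs k))).submatrix
              (fun b : ↥(pbox (fine Lc M')) × Fin (d + 1) => ((b.1, Sum.inl b.2) : Idx (fine Lc M') (Fib d)))
              (fun b : ↥(pbox (fine Lc M')) × Fin (d + 1) => ((b.1, Sum.inl b.2) : Idx (fine Lc M') (Fib d))))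
          (fromRows (Q M' (lev k) (rs k)) (combF Lc (fine Lc M') (rs k)))).det ≠ 0) →
      (∀ (k : ℕ) (M' : Fin (d + 1) → ℕ) [∀ μ, NeZero (M' μ)] (r' : Fin (d + 1) → ℕ),
        (effForm ((perF (fine Lc M') (K (lev k) (rs k))).submatrix
              (fun b : ↥(pbox (fine Lc M')) × Fin (d + 1) => ((b.1, Sum.inl b.2) : Idx (fine Lc M') (Fib d)))
              (fun b : ↥(pbox (fine Lc M')) × Fin (d + 1) => ((b.1, Sum.inl b.2) : Idx (fine Lc M') (Fib d))))
            (fromRows (Q M' (lev k) (rs k)) (combF Lc (fine Lc M') (rs k)))).toBlocks₁₁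
          = (wVH d Lc (lev k + 1))⁻¹ • (perF M' (K (lev k + 1) r')).submatrix
              (fun b : ↥(pbox M') × Fin (d + 1) => ((b.1, Sum.inl b.2) : Idx M' (Fib d)))
              (fun b : ↥(pbox M') × Fin (d + 1) => ((b.1, Sum.inl b.2) : Idx M' (Fib d)))) →
      (kkt ((perF (towerTorus Lc M (n + 1)) (K (lev (n + 1)) (rs (n + 1)))).submatrix
          (fun b : ↥(pbox (towerTorus Lc M (n + 1))) × Fin (d + 1) => ((b.1, Sum.inl b.2) : Idx (towerTorus Lc M (n + 1)) (Fib d)))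
          (fun b : ↥(pbox (towerTorus Lc M (n + 1))) × Fin (d + 1) => ((b.1, Sum.inl b.2) : Idx (towerTorus Lc M (n + 1)) (Fib d))))
          (fromRows (compRowsG Lc Q M lev rs (n + 1)) (nestedSliceG Lc Q (fine Lc M) (fun k => lev (k + 1)) (fun k => rs (k + 1)) n))).det ≠ 0
      ∧ ∀ r' : Fin (d + 1) → ℕ,
        (effForm ((perF (towerTorus Lc M (n + 1)) (K (lev (n + 1)) (rs (n + 1)))).submatrix
          (fun b : ↥(pbox (towerTorus Lc M (n + 1))) × Fin (d + 1) => ((b.1, Sum.inl b.2) : Idx (towerTorus Lc M (n + 1)) (Fib d)))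
          (fun b : ↥(pbox (towerTorus Lc M (n + 1))) × Fin (d + 1) => ((b.1, Sum.inl b.2) : Idx (towerTorus Lc M (n + 1)) (Fib d))))
            (fromRows (compRowsG Lc Q M lev rs (n + 1)) (nestedSliceG Lc Q (fine Lc M) (fun k => lev (k + 1)) (fun k => rs (k + 1)) n))).toBlocks₁₁
          = (∏ i ∈ range (n + 1), (wVH d Lc (lev i))⁻¹) • ((perF M (K (lev 0) r')).submatrix
          (fun b : ↥(pbox M) × Fin (d + 1) => ((b.1, Sum.inl b.2) : Idx M (Fib d)))
          (fun b : ↥(pbox M) × Fin (d + 1) => ((b.1, Sum.inl b.2) : Idx M (Fib d)))) := by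
  induction n with
  | zero =>
    intro M _ lev rs hlev hH1 hId
    have e1 : compRowsG Lc Q M lev rs (0 + 1) = Q M (lev 1) (rs 1) := compRowsG_one Lc Q M lev rs
    have h01 : lev 0 = lev 1 + 1 := hlev 0
    refine ⟨?_, fun r' => ?_⟩
    · rw [e1]
      exact hH1 1 M
    · rw [e1, Finset.prod_range_one, h01]
      exact hId 1 M r'
  | succ n ih =>
    intro M _ lev rs hlev hH1 hId
    -- the tower below `M`: top torus `fine Lc M`, sequences shifted by one, letters shifted by one
    obtain ⟨ihInv, ihEff⟩ := ih (fine Lc M) (fun k => lev (k + 1)) (fun k => rs (k + 1)) (fun i => hlev (i + 1))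
      (fun k M' _ => hH1 (k + 1) M') (fun k M' _ r' => hId (k + 1) M' r')
    have hL0 : 0 < Lc := Nat.pos_of_ne_zero (NeZero.ne Lc)
    -- the constant of the tower below, and its non-vanishing
    have hc : (∏ i ∈ range (n + 1), (wVH d Lc (lev (i + 1)))⁻¹) ≠ 0 :=
      Finset.prod_ne_zero_iff.2 fun i _ => inv_ne_zero (wVH_pos (d := d) hL0 _).ne'
    -- (EFF) of the tower below, read with the top root `rs 1`: its effective corner IS the top step's fine form, scaled
    have hE := ihEff (rs 1)
    -- the top step's fine system is non-degenerate ((h1)₁), hence so is its scaled copy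
    have h1top := hH1 1 M
    have h2 : (kkt ((effForm ((perF (towerTorus Lc (fine Lc M) (n + 1)) (K (lev (n + 1 + 1)) (rs (n + 1 + 1)))).submatrix
          (fun b : ↥(pbox (towerTorus Lc (fine Lc M) (n + 1))) × Fin (d + 1) => ((b.1, Sum.inl b.2) : Idx (towerTorus Lc (fine Lc M) (n + 1)) (Fib d)))
          (fun b : ↥(pbox (towerTorus Lc (fine Lc M) (n + 1))) × Fin (d + 1) => ((b.1, Sum.inl b.2) : Idx (towerTorus Lc (fine Lc M) (n + 1)) (Fib d))))
        (fromRows (compRowsG Lc Q (fine Lc M) (fun k => lev (k + 1)) (fun k => rs (k + 1)) (n + 1))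
          (nestedSliceG Lc Q (fine Lc (fine Lc M)) (fun k => lev (k + 1 + 1)) (fun k => rs (k + 1 + 1)) n))).toBlocks₁₁)
        (fromRows (Q M (lev 1) (rs 1)) (combF Lc (fine Lc M) (rs 1)))).det ≠ 0 := by
      rw [hE]
      exact (det_kkt_smul_form_ne_zero_iff hc _ _).2 h1top
    refine ⟨?_, fun r' => ?_⟩
    · -- (INV) at depth n+2: the OWNER's `det_kkt_compSliced_ne_zero` at `G := 0`, re-associated
      have h := det_kkt_compSliced_ne_zero _ (compRowsG Lc Q (fine Lc M) (fun k => lev (k + 1)) (fun k => rs (k + 1)) (n + 1))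
        (Q M (lev 1) (rs 1)) 0 _ (combF Lc (fine Lc M) (rs 1)) rfl ihInv (by rw [add_zero]; exact h2)
      rw [Matrix.mul_zero, Matrix.zero_mul, add_zero, ← det_kkt_fromRows_assoc] at h
      rw [nestedSliceG_succ, compRowsG_succ]
      exact h
    · -- (EFF) at depth n+2: tower (`EffFormTower`), then scaling, then the top step's (hId)₁
      have key := effForm_nested_corner_assoc _ _ _ (Q M (lev 1) (rs 1)) (combF Lc (fine Lc M) (rs 1))
        (isUnit_iff_ne_zero.2 ihInv) (isUnit_iff_ne_zero.2 h2)
      rw [nestedSliceG_succ, compRowsG_succ Lc Q M lev rs (n + 1)]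
      -- restate the goal in the syntactic shape of the tower below (`towerTorus Lc M (n+2) = towerTorus Lc (fine Lc M) (n+1)` by `rfl`)
      show (effForm ((perF (towerTorus Lc (fine Lc M) (n + 1)) (K (lev (n + 1 + 1)) (rs (n + 1 + 1)))).submatrix
          (fun b : ↥(pbox (towerTorus Lc (fine Lc M) (n + 1))) × Fin (d + 1) => ((b.1, Sum.inl b.2) : Idx (towerTorus Lc (fine Lc M) (n + 1)) (Fib d)))
          (fun b : ↥(pbox (towerTorus Lc (fine Lc M) (n + 1))) × Fin (d + 1) => ((b.1, Sum.inl b.2) : Idx (towerTorus Lc (fine Lc M) (n + 1)) (Fib d))))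
          (fromRows (Q M (lev 1) (rs 1) * compRowsG Lc Q (fine Lc M) (fun k => lev (k + 1)) (fun k => rs (k + 1)) (n + 1))
            (fromRows (combF Lc (fine Lc M) (rs 1) * compRowsG Lc Q (fine Lc M) (fun k => lev (k + 1)) (fun k => rs (k + 1)) (n + 1))
              (nestedSliceG Lc Q (fine Lc (fine Lc M)) (fun k => lev (k + 1 + 1)) (fun k => rs (k + 1 + 1)) n)))).toBlocks₁₁
        = (∏ i ∈ range (n + 1 + 1), (wVH d Lc (lev i))⁻¹) • ((perF M (K (lev 0) r')).submatrix
          (fun b : ↥(pbox M) × Fin (d + 1) => ((b.1, Sum.inl b.2) : Idx M (Fib d)))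
          (fun b : ↥(pbox M) × Fin (d + 1) => ((b.1, Sum.inl b.2) : Idx M (Fib d))))
      rw [key, hE]
      rw [Nat.zero_add, effForm_smul_form_toBlocks₁₁ hc _ _ _ (isUnit_iff_ne_zero.2 h1top), hId 1 M r', smul_smul, ← hlev 0,
        Finset.prod_range_succ' _ (n + 1)]

/-! ## §2 Consistency: at `Q := Qstep Lc`, `K ℓ r := bhKStepAt d (toSite r) Lc ℓ` the generic theorem is gen 28's rooted one -/

set_option synthInstance.maxSize 1024 in
/-- [consistency check, nothing new] the ROOTED instance of §1 — fed the OWNER's `torus_h1` and this lineage's `hId_order_zero_record` at the in-box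
roots `rs k`, and read through leaf-06's bridges `compRows_eq_compRowsG ∕ nestedSlice_eq_nestedSliceG` — has exactly the statement of
`TorusEffFormComposite.torus_composite_inv_and_eff` (whose consumers #19–#21 stay as they are). -/
example (n : ℕ) (M : Fin (d + 1) → ℕ) [∀ μ, NeZero (M μ)] (lev : ℕ → ℕ) (rs : ℕ → (Fin (d + 1) → ℕ))
    (hlev : ∀ i, lev i = lev (i + 1) + 1) (hrs : ∀ i, rs i ∈ box (d + 1) Lc) :
    (kkt ((perF (towerTorus Lc M (n + 1)) (bhKStepAt d (toSite (rs (n + 1))) Lc (lev (n + 1)))).submatrix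
          (fun b : ↥(pbox (towerTorus Lc M (n + 1))) × Fin (d + 1) => ((b.1, Sum.inl b.2) : Idx (towerTorus Lc M (n + 1)) (Fib d)))
          (fun b : ↥(pbox (towerTorus Lc M (n + 1))) × Fin (d + 1) => ((b.1, Sum.inl b.2) : Idx (towerTorus Lc M (n + 1)) (Fib d))))
          (fromRows (compRows Lc M lev rs (n + 1)) (nestedSlice Lc (fine Lc M) (fun k => lev (k + 1)) (fun k => rs (k + 1)) n))).det ≠ 0
      ∧ ∀ r' : Fin (d + 1) → ℕ,
        (effForm ((perF (towerTorus Lc M (n + 1)) (bhKStepAt d (toSite (rs (n + 1))) Lc (lev (n + 1)))).submatrix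
          (fun b : ↥(pbox (towerTorus Lc M (n + 1))) × Fin (d + 1) => ((b.1, Sum.inl b.2) : Idx (towerTorus Lc M (n + 1)) (Fib d)))
          (fun b : ↥(pbox (towerTorus Lc M (n + 1))) × Fin (d + 1) => ((b.1, Sum.inl b.2) : Idx (towerTorus Lc M (n + 1)) (Fib d))))
            (fromRows (compRows Lc M lev rs (n + 1)) (nestedSlice Lc (fine Lc M) (fun k => lev (k + 1)) (fun k => rs (k + 1)) n))).toBlocks₁₁
          = (∏ i ∈ range (n + 1), (wVH d Lc (lev i))⁻¹) • ((perF M (bhKStepAt d (toSite (r')) Lc (lev 0))).submatrix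
          (fun b : ↥(pbox M) × Fin (d + 1) => ((b.1, Sum.inl b.2) : Idx M (Fib d)))
          (fun b : ↥(pbox M) × Fin (d + 1) => ((b.1, Sum.inl b.2) : Idx M (Fib d)))) := by
  rw [compRows_eq_compRowsG, nestedSlice_eq_nestedSliceG]
  exact torus_composite_inv_and_eff_G Lc (fun M _ ℓ r => Qstep Lc M ℓ r) (fun ℓ r => bhKStepAt d (toSite r) Lc ℓ) n M lev rs hlev
    (fun k M' _ => torus_h1 M' (hrs k) (lev k))
    (fun k M' _ r' => hId_order_zero_record M' (hrs k) (lev k) r' (coarsePt M' Lc) (coarsePt_coe M' Lc) (coarseSlot_injective M')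
      (coarseSlot_range M'))

/-! ## §3 The (0.4)-symmetrised instance at the centred comb root — the object the re-based tower consumes -/

set_option synthInstance.maxSize 1024 in
/-- **[folklore] (INV-m) ∧ (EFF-m) FOR THE (0.4)-SYMMETRISED COMB TOWER** (R-D1-g52-1 (β1); the sym twin of
`TorusEffFormComposite.torus_composite_inv_and_eff` that the re-composed #19∕#20∕#21 read at its place): for leaf-06's `compRowsSym ∕ nestedSliceSym`
(one-step rows `QstepSym` over an1's shifted straight spread `𝕄_ℓ = bhKStepSh d Lc (Dsh Lc) ℓ`) at the CENTRED comb root `ctrOff (d+1) Lc` at every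
storey, with the fine forms the field blocks of `𝕄_ℓ` periodised, the `(n+1)`-step composite sliced system is (INV) non-degenerate and (EFF) has
effective-form corner `(∏ i ∈ range (n+1), (wVH d Lc (lev i))⁻¹) •` the field block of `𝕄_{lev 0}` periodised on `M` — §1 fed this lineage's
chart-(III′) torus letters `torus_h1_comb ∕ hId_comb` (centred root only; the kernel is root-free, so no `r′` remains on the right). -/
theorem torus_composite_inv_and_eff_sym (n : ℕ) (M : Fin (d + 1) → ℕ) [∀ μ, NeZero (M μ)] (lev : ℕ → ℕ)
    (hlev : ∀ i, lev i = lev (i + 1) + 1) :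
    (kkt ((perF (towerTorus Lc M (n + 1)) (bhKStepSh d Lc (Dsh Lc) (lev (n + 1)))).submatrix
          (fun b : ↥(pbox (towerTorus Lc M (n + 1))) × Fin (d + 1) => ((b.1, Sum.inl b.2) : Idx (towerTorus Lc M (n + 1)) (Fib d)))
          (fun b : ↥(pbox (towerTorus Lc M (n + 1))) × Fin (d + 1) => ((b.1, Sum.inl b.2) : Idx (towerTorus Lc M (n + 1)) (Fib d))))
          (fromRows (compRowsSym Lc M lev (fun _ => ctrOff (d + 1) Lc) (n + 1))
            (nestedSliceSym Lc (fine Lc M) (fun k => lev (k + 1)) (fun _ => ctrOff (d + 1) Lc) n))).det ≠ 0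
      ∧ (effForm ((perF (towerTorus Lc M (n + 1)) (bhKStepSh d Lc (Dsh Lc) (lev (n + 1)))).submatrix
          (fun b : ↥(pbox (towerTorus Lc M (n + 1))) × Fin (d + 1) => ((b.1, Sum.inl b.2) : Idx (towerTorus Lc M (n + 1)) (Fib d)))
          (fun b : ↥(pbox (towerTorus Lc M (n + 1))) × Fin (d + 1) => ((b.1, Sum.inl b.2) : Idx (towerTorus Lc M (n + 1)) (Fib d))))
            (fromRows (compRowsSym Lc M lev (fun _ => ctrOff (d + 1) Lc) (n + 1))
              (nestedSliceSym Lc (fine Lc M) (fun k => lev (k + 1)) (fun _ => ctrOff (d + 1) Lc) n))).toBlocks₁₁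
          = (∏ i ∈ range (n + 1), (wVH d Lc (lev i))⁻¹) • ((perF M (bhKStepSh d Lc (Dsh Lc) (lev 0))).submatrix
          (fun b : ↥(pbox M) × Fin (d + 1) => ((b.1, Sum.inl b.2) : Idx M (Fib d)))
          (fun b : ↥(pbox M) × Fin (d + 1) => ((b.1, Sum.inl b.2) : Idx M (Fib d)))) := by
  have h := torus_composite_inv_and_eff_G Lc (QSym Lc) (fun ℓ _ => bhKStepSh d Lc (Dsh Lc) ℓ) n M lev
    (fun _ => ctrOff (d + 1) Lc) hlev (fun k M' _ => torus_h1_comb M' (lev k)) (fun k M' _ _ => hId_comb M' (lev k))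
  exact ⟨h.1, h.2 (ctrOff (d + 1) Lc)⟩

end Summit.QuantumFields.BalabanUV.Beta.FP.TorusEffFormCompositeG

end
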